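import Literature.Analysis.FluidPDE.NSVorticityBKMHolds
import Literature.Analysis.FluidPDE.AxisymmetricEuler
import HarnessLib

/-!
# Pointwise blow-up forms of the Beale–Kato–Majda criterion (BKM class, `ν ≥ 0`)

The tree's Beale–Kato–Majda theorem in blow-up form,
`lintegral_iSup_curl_eq_top_of_not_hasSobolevExtensionPast_holds` (Beale–Kato–Majda 1984, Thm 1:
if a classical unforced solution on `ℝ³ × [0,T)` lying in `⋂ₛ C([0,T'']; Hˢ)` on every compact
sub-slab cannot be continued in the class past `T`, then `∫₀ᵀ ‖ω(t)‖_{L^∞} dt = ∞`), is turned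
into the pointwise statements that claim skeletons and blow-up scenarios quote:

* `exists_gt_norm_curl_of_not_hasSobolevExtensionPast` — for every bound `M` and every
  `t₀ ∈ [0,T)` there are `t ∈ (t₀,T)` and `x` with `‖ω(t,x)‖ > M` (the vorticity is unbounded on
  every end-slab `(t₀,T) × ℝ³`); the proof splits `∫₀ᵀ` at `t₀`: on `[0,t₀]` the vorticity is
  bounded by the Sobolev imbedding (`exists_enorm_curl_le_of_hasBoundedSobolevNormsOn`), so a
  bound `M` on `(t₀,T)` would make the BKM integral finite;
* `vorticityBlowsUpAt_of_not_hasSobolevExtensionPast` — the accepted filter form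
  `VorticityBlowsUpAt u T` (`∀ M, ∃ᶠ t in 𝓝[<] T, ∃ x, M < ‖curl (u t) x‖`, i.e.
  `limsup_{t↑T} ‖ω(t)‖_{L^∞} = ∞`, Majda–Bertozzi (3.72));
* `exists_gt_norm_fderiv_of_not_hasSobolevExtensionPast`,
  `frequently_exists_gt_norm_fderiv_of_not_hasSobolevExtensionPast` — the same for the velocity
  gradient (`‖ω‖ ≤ 4‖∇u‖`, `norm_curl_le_four_mul`), i.e. `limsup_{t↑T} ‖∇u(t)‖_{L^∞} = ∞`;
* `…_of_not_hasSmoothExtensionPast` — the variants with "no classical continuation past `T`"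
  (`¬ HasSmoothExtensionPast ν 0 u T`, which implies no continuation in the class).

Theorems only; no new definitions or facts.

## References
* [BealeKatoMajda1984] J. T. Beale, T. Kato, A. Majda, Comm. Math. Phys. 94 (1984) 61–66, Thm 1.
* [MajdaBertozzi2002] A. Majda, A. Bertozzi, Vorticity and Incompressible Flow, CUP 2002,
  Thm 3.6 / (3.72), remark p. 117.
-/

open Set MeasureTheory Filter
open scoped ENNReal Topology

namespace Literature.Analysis.FluidPDE

/-- Filter bookkeeping: "for every `t₀ < T` some `t ∈ (t₀,T)` has `P t`" is
"`P` holds frequently as `t ↑ T`". [folklore] -/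
private theorem frequently_nhdsLT_of_forall_exists_Ioo {P : ℝ → Prop} {T : ℝ}
    (h : ∀ t₀ < T, ∃ t ∈ Ioo t₀ T, P t) : ∃ᶠ t in 𝓝[<] T, P t := by
  rw [Filter.frequently_iff]
  intro U hU
  obtain ⟨a, ha, hsub⟩ := mem_nhdsLT_iff_exists_Ioo_subset.1 hU
  obtain ⟨t, ht, hP⟩ := h a ha
  exact ⟨t, hsub ht, hP⟩

variable {ν T : ℝ} {u : ℝ → EuclideanSpace ℝ (Fin 3) → EuclideanSpace ℝ (Fin 3)}
  {p : ℝ → EuclideanSpace ℝ (Fin 3) → ℝ}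

/-- **Vorticity unbounded on every end-slab at a blow-up time of the BKM class** (`ν ≥ 0`;
Beale–Kato–Majda 1984, Thm 1, pointwise form): if the classical unforced solution `(u,p)` on
`ℝ³ × [0,T)` lies in the class on every `[0,T'']`, `T'' < T`, and cannot be continued in the class
past `T`, then for every `M` and every `t₀ ∈ [0,T)` there are `t ∈ (t₀,T)` and `x` with
`M < ‖curl u(t,x)‖`. [cite: BealeKatoMajda1984, Thm 1] [cite: MajdaBertozzi2002, Thm 3.6 / (3.72)] -/
theorem exists_gt_norm_curl_of_not_hasSobolevExtensionPast (hν : 0 ≤ ν) (hT : 0 < T)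
    (hsol : IsClassicalNSSolutionOn (Ico 0 T) ν 0 u p)
    (hreg : ∀ T'' < T, HasBoundedSobolevNormsOn (Icc 0 T'') u)
    (hmax : ¬ HasSobolevExtensionPast ν u T) (M : ℝ) {t₀ : ℝ} (ht₀ : t₀ ∈ Ico 0 T) :
    ∃ t ∈ Ioo t₀ T, ∃ x, M < ‖curl (u t) x‖ := by
  by_contra hcon
  push Not at hcon
  -- vorticity bound on the compact sub-slab `[0,t₀]`
  obtain ⟨R, hRtop, hR⟩ := exists_enorm_curl_le_of_hasBoundedSobolevNormsOn
    (fun t ht => hsol.contDiff_velocity ⟨ht.1, ht.2.trans_lt ht₀.2⟩) (hreg t₀ ht₀.2)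
  have hmaj : ∀ t ∈ Ioo 0 T, (⨆ x, ‖curl (u t) x‖ₑ) ≤ R + ENNReal.ofReal M := by
    intro t ht
    refine iSup_le fun x => ?_
    rcases le_or_gt t t₀ with hle | hlt
    · exact (hR t ⟨ht.1.le, hle⟩ x).trans le_self_add
    · rw [← ofReal_norm]
      exact (ENNReal.ofReal_le_ofReal (hcon t ⟨hlt, ht.2⟩ x)).trans le_add_self
  have hfin : (∫⁻ t in Ioo 0 T, ⨆ x, ‖curl (u t) x‖ₑ) < ⊤ := by
    calc (∫⁻ t in Ioo 0 T, ⨆ x, ‖curl (u t) x‖ₑ)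
        ≤ ∫⁻ _ in Ioo 0 T, (R + ENNReal.ofReal M) := setLIntegral_mono measurable_const hmaj
      _ < ⊤ := by
          rw [setLIntegral_const, Real.volume_Ioo]
          exact ENNReal.mul_lt_top (ENNReal.add_lt_top.2 ⟨hRtop, ENNReal.ofReal_lt_top⟩)
            ENNReal.ofReal_lt_top
  exact hfin.ne (lintegral_iSup_curl_eq_top_of_not_hasSobolevExtensionPast_holds hν hT hsol hreg hmax)

/-- **`limsup_{t↑T} ‖ω(t)‖_{L^∞} = ∞` at a blow-up time of the BKM class** (`ν ≥ 0`), in the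
accepted filter form `VorticityBlowsUpAt u T`. [cite: BealeKatoMajda1984, Thm 1] [cite: MajdaBertozzi2002, Thm 3.6 / (3.72)] -/
theorem vorticityBlowsUpAt_of_not_hasSobolevExtensionPast (hν : 0 ≤ ν) (hT : 0 < T)
    (hsol : IsClassicalNSSolutionOn (Ico 0 T) ν 0 u p)
    (hreg : ∀ T'' < T, HasBoundedSobolevNormsOn (Icc 0 T'') u)
    (hmax : ¬ HasSobolevExtensionPast ν u T) : VorticityBlowsUpAt u T := by
  intro M
  refine frequently_nhdsLT_of_forall_exists_Ioo fun t₀ ht₀ => ?_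
  obtain ⟨t, ht, hx⟩ := exists_gt_norm_curl_of_not_hasSobolevExtensionPast hν hT hsol hreg hmax M
    (t₀ := max t₀ 0) ⟨le_max_right _ _, max_lt ht₀ hT⟩
  exact ⟨t, ⟨(le_max_left _ _).trans_lt ht.1, ht.2⟩, hx⟩

/-- **Velocity gradient unbounded on every end-slab at a blow-up time of the BKM class**
(`ν ≥ 0`): for every `M` and `t₀ ∈ [0,T)` there are `t ∈ (t₀,T)` and `x` with `M < ‖∇u(t,x)‖`
(from the vorticity form and `‖ω‖ ≤ 4‖∇u‖`). [cite: BealeKatoMajda1984, Thm 1] [cite: MajdaBertozzi2002, (3.79)–(3.83)] -/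
theorem exists_gt_norm_fderiv_of_not_hasSobolevExtensionPast (hν : 0 ≤ ν) (hT : 0 < T)
    (hsol : IsClassicalNSSolutionOn (Ico 0 T) ν 0 u p)
    (hreg : ∀ T'' < T, HasBoundedSobolevNormsOn (Icc 0 T'') u)
    (hmax : ¬ HasSobolevExtensionPast ν u T) (M : ℝ) {t₀ : ℝ} (ht₀ : t₀ ∈ Ico 0 T) :
    ∃ t ∈ Ioo t₀ T, ∃ x, M < ‖fderiv ℝ (u t) x‖ := by
  obtain ⟨t, ht, x, hx⟩ := exists_gt_norm_curl_of_not_hasSobolevExtensionPast hν hT hsol hreg hmax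
    (4 * max M 0) ht₀
  refine ⟨t, ht, x, (le_max_left M 0).trans_lt ?_⟩
  have h4 := hx.trans_le (norm_curl_le_four_mul (u t) x)
  linarith

/-- **`limsup_{t↑T} ‖∇u(t)‖_{L^∞} = ∞` at a blow-up time of the BKM class** (`ν ≥ 0`), filter
form. [cite: BealeKatoMajda1984, Thm 1] [cite: MajdaBertozzi2002, (3.79)–(3.83)] -/
theorem frequently_exists_gt_norm_fderiv_of_not_hasSobolevExtensionPast (hν : 0 ≤ ν) (hT : 0 < T)
    (hsol : IsClassicalNSSolutionOn (Ico 0 T) ν 0 u p)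
    (hreg : ∀ T'' < T, HasBoundedSobolevNormsOn (Icc 0 T'') u)
    (hmax : ¬ HasSobolevExtensionPast ν u T) (M : ℝ) :
    ∃ᶠ t in 𝓝[<] T, ∃ x, M < ‖fderiv ℝ (u t) x‖ := by
  refine frequently_nhdsLT_of_forall_exists_Ioo fun t₀ ht₀ => ?_
  obtain ⟨t, ht, hx⟩ := exists_gt_norm_fderiv_of_not_hasSobolevExtensionPast hν hT hsol hreg hmax M
    (t₀ := max t₀ 0) ⟨le_max_right _ _, max_lt ht₀ hT⟩
  exact ⟨t, ⟨(le_max_left _ _).trans_lt ht.1, ht.2⟩, hx⟩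

/-! ### Variants with "no classical continuation past `T`"

`¬ HasSmoothExtensionPast ν 0 u T` (no classical solution on a longer slab agreeing with `u` on
`[0,T)`) implies `¬ HasSobolevExtensionPast ν u T` (`HasSobolevExtensionPast.hasSmoothExtensionPast`),
so every statement above holds verbatim under the formally stronger blow-up hypothesis that claim
skeletons usually type («`t*` is the maximal time of smoothness»). -/

/-- Vorticity unbounded on every end-slab when there is no classical continuation past `T`
(BKM class, `ν ≥ 0`). [cite: BealeKatoMajda1984, Thm 1 and §1] -/
theorem exists_gt_norm_curl_of_not_hasSmoothExtensionPast (hν : 0 ≤ ν) (hT : 0 < T)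
    (hsol : IsClassicalNSSolutionOn (Ico 0 T) ν 0 u p)
    (hreg : ∀ T'' < T, HasBoundedSobolevNormsOn (Icc 0 T'') u)
    (hmax : ¬ HasSmoothExtensionPast ν 0 u T) (M : ℝ) {t₀ : ℝ} (ht₀ : t₀ ∈ Ico 0 T) :
    ∃ t ∈ Ioo t₀ T, ∃ x, M < ‖curl (u t) x‖ :=
  exists_gt_norm_curl_of_not_hasSobolevExtensionPast hν hT hsol hreg
    (fun h => hmax h.hasSmoothExtensionPast) M ht₀

/-- `VorticityBlowsUpAt u T` when there is no classical continuation past `T` (BKM class,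
`ν ≥ 0`). [cite: BealeKatoMajda1984, Thm 1 and §1] -/
theorem vorticityBlowsUpAt_of_not_hasSmoothExtensionPast (hν : 0 ≤ ν) (hT : 0 < T)
    (hsol : IsClassicalNSSolutionOn (Ico 0 T) ν 0 u p)
    (hreg : ∀ T'' < T, HasBoundedSobolevNormsOn (Icc 0 T'') u)
    (hmax : ¬ HasSmoothExtensionPast ν 0 u T) : VorticityBlowsUpAt u T :=
  vorticityBlowsUpAt_of_not_hasSobolevExtensionPast hν hT hsol hreg
    fun h => hmax h.hasSmoothExtensionPast

/-- Velocity gradient unbounded on every end-slab when there is no classical continuation past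
`T` (BKM class, `ν ≥ 0`). [cite: BealeKatoMajda1984, Thm 1 and §1] -/
theorem exists_gt_norm_fderiv_of_not_hasSmoothExtensionPast (hν : 0 ≤ ν) (hT : 0 < T)
    (hsol : IsClassicalNSSolutionOn (Ico 0 T) ν 0 u p)
    (hreg : ∀ T'' < T, HasBoundedSobolevNormsOn (Icc 0 T'') u)
    (hmax : ¬ HasSmoothExtensionPast ν 0 u T) (M : ℝ) {t₀ : ℝ} (ht₀ : t₀ ∈ Ico 0 T) :
    ∃ t ∈ Ioo t₀ T, ∃ x, M < ‖fderiv ℝ (u t) x‖ :=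
  exists_gt_norm_fderiv_of_not_hasSobolevExtensionPast hν hT hsol hreg
    (fun h => hmax h.hasSmoothExtensionPast) M ht₀

/-- `limsup_{t↑T} ‖∇u(t)‖_{L^∞} = ∞` (filter form) when there is no classical continuation
past `T` (BKM class, `ν ≥ 0`). [cite: BealeKatoMajda1984, Thm 1 and §1] -/
theorem frequently_exists_gt_norm_fderiv_of_not_hasSmoothExtensionPast (hν : 0 ≤ ν) (hT : 0 < T)
    (hsol : IsClassicalNSSolutionOn (Ico 0 T) ν 0 u p)
    (hreg : ∀ T'' < T, HasBoundedSobolevNormsOn (Icc 0 T'') u)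
    (hmax : ¬ HasSmoothExtensionPast ν 0 u T) (M : ℝ) :
    ∃ᶠ t in 𝓝[<] T, ∃ x, M < ‖fderiv ℝ (u t) x‖ :=
  frequently_exists_gt_norm_fderiv_of_not_hasSobolevExtensionPast hν hT hsol hreg
    (fun h => hmax h.hasSmoothExtensionPast) M

end Literature.Analysis.FluidPDE
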